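import Summits.AtomisticToContinuum.Crystallization.Theorems.ThreeConeCertificateSlackRigidityPalmReduction
import Summits.AtomisticToContinuum.Crystallization.Theorems.ThreeConeCertificateSlackRigidityUniqFinal
import Summits.AtomisticToContinuum.Crystallization.Theorems.ThreeConeCertificateSlackRigidityReduction
import Summits.AtomisticToContinuum.Crystallization.Theorems.ThreeConeCertificateSlackRigidityRodReduction
import Summits.AtomisticToContinuum.Crystallization.Theorems.ThreeConeCertificateSlackRigidityQuasiRegularisation
import Summits.AtomisticToContinuum.Crystallization.Theorems.ThreeConeCertificateSlackRigidityBSLimitSupported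
import Summits.AtomisticToContinuum.Crystallization.Theorems.ThreeConeCertificateSlackRigidityLocalLimitGSC
import Literature.Probability.Process.LocalRubberHardCore
import Literature.MathematicalPhysics.StatisticalMechanics.RootEnergy
import Literature.MathematicalPhysics.StatisticalMechanics.HardCoreGSC
import Summits.AtomisticToContinuum.Crystallization.Theorems.ThreeConeCertificateKeplerBoundOfBulkDefectVanish
import Summits.AtomisticToContinuum.Crystallization.Theorems.ThreeConeCertificateSlackRigidityRootLawReduction
import Summits.AtomisticToContinuum.Crystallization.Theorems.ThreeConeCertificateSlackRigidityOfPalmRigidity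
import Summits.AtomisticToContinuum.Crystallization.Theorems.ThreeConeCertificateSlackRigidityPinsMinimisers
import HarnessLib

/-!
# Crux `SlackRigidity` (stmt-AtomisticToContinuum-11960) — line `ekeland-surgery-parity`,
# skeleton of lead c12 (= FINAL skeleton of leads c6/c7, re-checked; both landed closures imported;
# c12's landed necessary conditions read back):
# the crux is `PalmRigidity` (item stmt-AtomisticToContinuum-9224) away — equivalently the WEAKER
# unfiled `RootLawRigidityLe` away; regularisation (E1–E3), BS limit with support, local limits of
# quasi-ground-states are GSCs, and both compositions are LANDED

Lead c12 (2026-08-16T22:40Z): state of the crux re-verified UNCHANGED (items 9224/9225/9226/11959/11961/0751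
open, Disproof.lean v6 unchanged, no `-- Targets`; the ONLY `sorry` below is still `stub_palmRigidity` =
item 9224).  NEW, landed by c12 and read back in § Readback: the NECESSARY CONDITIONS
`SlackRigidityPinsMinimisers.slackRigidity_pins_minimisers` (p127721: the witness is a periodic
Lennard-Jones minimiser and EVERY periodic minimiser is two-way `ε`-congruent to it at every site, all
`R, ε`) and `SlackRigidityPinsMinimisers.slackRigidity_minimisers_congruent` /
`not_slackRigidity_of_incongruent_minimisers` (p128258: any two periodic minimisers are mutually
locally congruent; two incongruent periodic minimisers refute the crux).

Lead c7 (2026-08-16T20:40Z): state re-verified unchanged — items 9224/9225/9226/11959/11961/0751 all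
`open`, Disproof.lean v6 (05:25Z) unchanged with no `-- Targets`; the two landed closures
`EkelandSurgeryParityClosure.slackRigidity_of_palmRigidity` (p122051) and
`EkelandRootLawReduction.slackRigidity_of_palmRigidity_viaGSC` (p124681, whose module the farm had not
built at c6's registration) are now IMPORTED and read back below by name.

Route `ThreeConeCertificate`, sub-problem `Crystallization`.  Every piece of the line is landed in the
tree; the ONLY `sorry` of this file is the registered stub

* `stub_palmRigidity : PalmRigidity` — BY NAME the target decl of route `PalmUnimodularRigidity`
  (item stmt-AtomisticToContinuum-9224, open; glued in-tree from its cruxes 9225 ∧ 9226 ∧ 9227),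

and `SlackRigidity_of` concludes the crux BY NAME from it through the landed Palm reduction
(p112833) and the landed certified-numerics uniqueness (p115896); the one-hypothesis closure
`EkelandSurgeryParityClosure.slackRigidity_of_palmRigidity : PalmRigidity → SlackRigidity` is landed
(p122051).

Lead c6 (this cycle) registered and LANDED the line's bypassed first stub (`QuasiRegularisation`) as
`stub_hammingEkeland` (p123674), `stub_qgsSeparation` (p123701), `stub_badCountTransfer` (p123659) and
the composition `EkelandQuasiRegularisation.{quasiRegularisation, slackRigidity_iff_qgsRigidity,
slackRigidity_iff_separated}` (`Theorems/ThreeConeCertificateSlackRigidityQuasiRegularisation.lean`);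
the three registered stubs are kept below as aliases of the landed theorems (no `sorry`).

Cycle 2 registered and LANDED the planner's stubs 2–3 of the original skeleton — `stub_hardCoreBSLimit`
(Benjamini–Schramm limit WITH SUPPORT, p124290) and `stub_localLimitGSC` (local limits of `λ_k → 0`
quasi-ground-states are hard-core GSCs, p124515) — and the composition
`EkelandRootLawReduction.slackRigidity_of_rootLawRigidity` (p124681): the crux follows from rigidity of
minimising GSC-SUPPORTED point-stationary hard-core laws (`RootLawRigidityLe` = planner's stub 5 with `≤ e`, unfiled), which is itself
implied by `PalmRigidity` (`EkelandRootLawReduction.rootLawRigidity_of_palmRigidity`).  The cycle-2 stubs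
are kept below as aliases too.

State of the crux (all names elaborate below, § Readback): three independent in-tree transfers onto
`SlackRigidity` (`CLayerWitnessReduction.slackRigidity_of_strictCertificate`,
`SignedRootReduction.slackRigidity_of_localisedCertificate`, the Palm reduction used here); the crux
is summit-hard (`KeplerBoundBulk.crystallization_of_slackRigidity : SlackRigidity → Crystallization`);
honest status "closed modulo 9224".
-/

noncomputable section

namespace Summit.AtomisticToContinuum.Crystallization.Cruxes.SlackRigidity.EkelandSurgeryParity

open scoped BigOperators Topology
open MeasureTheory Filter Set
open Literature.Probability.Process
open Literature.MathematicalPhysics.StatisticalMechanics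
open Summit.AtomisticToContinuum.Crystallization.Theses.ThreeConeCertificate (SlackRigidity)
open Summit.AtomisticToContinuum.Crystallization.Theses.PalmUnimodularRigidity (PalmRigidity)
open Summit.AtomisticToContinuum.Crystallization.Theorems
open Summit.AtomisticToContinuum.Crystallization.Theorems.SlackRigidityNegative
  (E3 Good badCount BadFractionVanishes ExcessVanishes RigidFor)

/-! ## Registered stub 0 (open problem, = item 9224) — the ONLY `sorry` -/

/-- **Registered stub `stub_palmRigidity`** = the target `PalmRigidity` of route
`PalmUnimodularRigidity` (item stmt-AtomisticToContinuum-9224), by name. OPEN (it is the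
measure-level form of 3-D Lennard-Jones crystallization). -/
theorem stub_palmRigidity : PalmRigidity := by
  sorry

/-! ## The composition (sorry-free given `stub_palmRigidity`) -/

/-- **The crux from the stub**: `PalmRigidity ⇒ SlackRigidity` through the landed Palm reduction
and the landed uniqueness of the relaxed-hcp optimum up to congruence. -/
theorem SlackRigidity_of : SlackRigidity :=
  EkelandSurgeryParityReduction.slackRigidity_of_palmRigidity_of_hcpOptimalCongruent
    stub_palmRigidity EkelandSurgeryParityUniqFinal.stub_hcpOptimalCongruent

/-! ## Registered stubs E1–E3 — LANDED (aliases of the tree theorems, no `sorry`) -/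

/-- **Stub E1 — Hamming–Ekeland principle** (LANDED p123674). -/
theorem stub_hammingEkeland :
    ∀ (N : ℕ) (lam : ℝ), 0 < lam → ∀ x : Fin N → E3, Function.Injective x →
      ∃ x' : Fin N → E3, Function.Injective x' ∧
        (∀ y : Fin N → E3, Function.Injective y →
          interactionEnergy lennardJones x' -
              lam * ((Finset.univ.filter fun i => y i ≠ x' i).card : ℝ) ≤
            interactionEnergy lennardJones y) ∧
        interactionEnergy lennardJones x' ≤ interactionEnergy lennardJones x ∧
        lam * ((Finset.univ.filter fun i => x' i ≠ x i).card : ℝ) ≤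
          interactionEnergy lennardJones x - interactionEnergy lennardJones x' :=
  EkelandHammingEkeland.stub_hammingEkeland

/-- **Stub E2 — quasi-ground-states are uniformly separated** (LANDED p123701). -/
theorem stub_qgsSeparation :
    ∀ (N : ℕ) (lam : ℝ), lam ≤ 10 ^ 4 → ∀ x : Fin N → E3, Function.Injective x →
      (∀ y : Fin N → E3, Function.Injective y →
        interactionEnergy lennardJones x -
            lam * ((Finset.univ.filter fun i => y i ≠ x i).card : ℝ) ≤
          interactionEnergy lennardJones y) →
      ∀ i j : Fin N, i ≠ j → (1 / 3 : ℝ) ≤ dist (x i) (x j) :=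
  EkelandQgsSeparation.stub_qgsSeparation

/-- **Stub E3 — bad counts move by `O(Hamming distance)`** (LANDED p123659). -/
theorem stub_badCountTransfer :
    ∀ (P : PeriodicConfiguration 3) (R ε δ : ℝ), 0 < R → 0 < ε → 0 < δ → ∃ C : ℝ, 0 ≤ C ∧
      ∀ (N : ℕ) (x x' : Fin N → E3), (∀ i j : Fin N, i ≠ j → δ ≤ dist (x' i) (x' j)) →
        (badCount P R ε x : ℝ) ≤
          badCount P R ε x' + C * ((Finset.univ.filter fun i => x' i ≠ x i).card : ℝ) :=
  EkelandBadCountTransfer.stub_badCountTransfer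


/-! ## Registered stubs of cycle 2 — LANDED (aliases of the tree theorems, no `sorry`) -/

/-- **Stub `stub_hardCoreBSLimit` — Benjamini–Schramm limit of a separated family WITH SUPPORT**
(LANDED p124290). -/
theorem stub_hardCoreBSLimit :
    ∀ δ : ℝ, 0 < δ → ∀ (n : ℕ → ℕ) (x : (k : ℕ) → (Fin (n k) → E3)), (∀ k, 1 ≤ n k) →
    (∀ k (i j : Fin (n k)), i ≠ j → δ ≤ dist (x k i) (x k j)) →
    ∃ φ : ℕ → ℕ, StrictMono φ ∧ ∃ P : Measure (Measure E3),
      IsProbabilityMeasure P ∧ (∀ᵐ μ ∂P, IsRootedHardCore δ μ) ∧ IsPointStationaryLaw P ∧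
      (∀ᵐ μ ∂P, ∃ ψ : ℕ → ℕ, StrictMono ψ ∧ ∃ i : (k : ℕ) → Fin (n (φ (ψ k))),
        ∀ R ε : ℝ, 0 < ε → ∀ᶠ k : ℕ in atTop,
          LocallyMatches R ε
            (Set.range fun j : Fin (n (φ (ψ k))) => x (φ (ψ k)) j - x (φ (ψ k)) (i k)) (atoms μ)) ∧
      Tendsto (fun j : ℕ => interactionEnergy lennardJones (x (φ j)) / (n (φ j) : ℝ)) atTop
        (𝓝 (∫ μ, rootEnergy lennardJones μ ∂P)) ∧
      ∀ (T : Set (Measure E3)) (R' ε : ℝ), 0 < ε → ∀ ρ : ℝ, ρ < (P T).toReal →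
        ∀ᶠ j : ℕ in atTop, ρ * (n (φ j) : ℝ) ≤
          (Nat.card {i : Fin (n (φ j)) // ∃ ν ∈ T,
            LocallyMatches R' ε (Set.range fun k : Fin (n (φ j)) => x (φ j) k - x (φ j) i)
              (atoms ν)} : ℝ) :=
  EkelandBSLimitSupported.stub_hardCoreBSLimit

/-- **Stub `stub_localLimitGSC` — local limits of quasi-ground-states are hard-core GSCs**
(LANDED p124515). -/
theorem stub_localLimitGSC :
    ∀ δ : ℝ, 0 < δ → ∀ (n : ℕ → ℕ) (y : (k : ℕ) → (Fin (n k) → E3)) (c : ℕ → E3) (lam : ℕ → ℝ),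
    (∀ k, Function.Injective (y k) ∧ ∀ z : Fin (n k) → E3, Function.Injective z →
      interactionEnergy lennardJones (y k) -
          lam k * ((Finset.univ.filter fun i => z i ≠ y k i).card : ℝ) ≤
        interactionEnergy lennardJones z) →
    Tendsto lam atTop (𝓝 0) →
    (∀ k (i j : Fin (n k)), i ≠ j → δ ≤ dist (y k i) (y k j)) →
    ∀ S : Set E3,
      (∀ R ε : ℝ, 0 < ε → ∀ᶠ k : ℕ in atTop,
        LocallyMatches R ε (Set.range fun i : Fin (n k) => y k i - c k) S) →
      IsHardCoreGSC lennardJones S :=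
  EkelandLocalLimitGSC.stub_localLimitGSC

/-! ## Readback of the landed composition and of the state of the crux (tree theorems, by name) -/

-- the planner's `QuasiRegularisation`, now a theorem:
example := @EkelandQuasiRegularisation.quasiRegularisation
-- the crux ⟺ rigidity of `λ_N → 0` quasi-ground-states (right side at `λ ≡ 0` = hinge 0751 verbatim):
example : SlackRigidity ↔
    ∃ P : PeriodicConfiguration 3, ∀ R ε : ℝ, 0 < R → 0 < ε →
      ∀ (lam : ℕ → ℝ) (x : (N : ℕ) → (Fin N → E3)), (∀ N, 0 ≤ lam N) →
        (∀ N, Function.Injective (x N) ∧ ∀ y : Fin N → E3, Function.Injective y →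
          interactionEnergy lennardJones (x N) -
              lam N * ((Finset.univ.filter fun i => y i ≠ x N i).card : ℝ) ≤
            interactionEnergy lennardJones y) →
        Tendsto lam atTop (𝓝 0) →
        Tendsto (fun N : ℕ => (badCount P R ε (x N) : ℝ) / N) atTop (𝓝 0) :=
  EkelandQuasiRegularisation.slackRigidity_iff_qgsRigidity
-- the crux ⟺ the crux on `1/3`-separated sequences:
example : SlackRigidity ↔
    ∃ P : PeriodicConfiguration 3, ∀ R ε : ℝ, 0 < R → 0 < ε →
      ∀ x : (N : ℕ) → (Fin N → E3), (∀ N, Function.Injective (x N)) →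
        (∀ N (i j : Fin N), i ≠ j → (1 / 3 : ℝ) ≤ dist (x N i) (x N j)) →
        ExcessVanishes x → BadFractionVanishes P R ε x :=
  EkelandQuasiRegularisation.slackRigidity_iff_separated
-- the GSC refinement (cycle 2 of c6) is landed (p124681): `RootLawRigidityLe → SlackRigidity` …
example := @EkelandRootLawReduction.slackRigidity_of_rootLawRigidity
-- … its residual is implied by item 9224 …
example := @EkelandRootLawReduction.rootLawRigidity_of_palmRigidity
-- … hence a second kernel-checked `PalmRigidity → SlackRigidity`:
example (h : PalmRigidity) : SlackRigidity := EkelandRootLawReduction.slackRigidity_of_palmRigidity_viaGSC h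
-- the one-hypothesis closure is landed (p122051) — the closing file of the crux, once item 9224 has a
-- `PalmRigidity_holds`, is the single line
-- `theorem SlackRigidity_proof : SlackRigidity := EkelandSurgeryParityClosure.slackRigidity_of_palmRigidity PalmRigidity_holds`:
example (h : PalmRigidity) : SlackRigidity := EkelandSurgeryParityClosure.slackRigidity_of_palmRigidity h
-- and the crux also follows from the two open CRUXES 9225 ∧ 9226 of route `PalmUnimodularRigidity`:
example := @EkelandSurgeryParityClosure.slackRigidity_of_minimiserShells_of_layeredLawsSelectHcp
-- the two certificate transfers of the other lines (hypotheses are strengthened forms of 11959):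
example := @CLayerWitnessReduction.slackRigidity_of_strictCertificate
example := @SignedRootReduction.slackRigidity_of_localisedCertificate
-- necessary conditions landed by lead c12 (p127721 + its corollary file): the witness is a periodic
-- minimiser pinning every periodic minimiser locally; all periodic minimisers are mutually congruent;
-- two incongruent periodic minimisers would refute the crux:
example := @SlackRigidityPinsMinimisers.slackRigidity_pins_minimisers
example := @SlackRigidityPinsMinimisers.siteMatched_of_rigidFor
-- (in module `…Theorems.ThreeConeCertificateSlackRigidityMinimisersCongruent`, p128258, not imported
-- here only because the hub had not built its olean when this skeleton was re-published:
-- `SlackRigidityPinsMinimisers.slackRigidity_minimisers_congruent`,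
-- `SlackRigidityPinsMinimisers.slackRigidity_minimiser_vertexTransitive`,
-- `SlackRigidityPinsMinimisers.not_slackRigidity_of_incongruent_minimisers`.)
-- the crux implies the whole sub-problem conjunct:
example (h : SlackRigidity) : _root_.Crystallization := KeplerBoundBulk.crystallization_of_slackRigidity h

end Summit.AtomisticToContinuum.Crystallization.Cruxes.SlackRigidity.EkelandSurgeryParity

end
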